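import Literature.MathematicalPhysics.QuantumFieldTheory.BalabanImbrieJaffe1984to88.BIJ88OneCubeSlotEstimates309

/-!
# `BalabanImbrieJaffe1984to88.BIJ88OneCubeVertexFactors309` — T. Bałaban, J. Imbrie, A. Jaffe, *Effective action and cluster properties of the
abelian Higgs model*, Commun. Math. Phys. **114** (1988) 257–315 [BalabanImbrieJaffe1988], Sect. 5.14 p. 309 [PDF 53] with p. 307 [PDF 51]:
**THE ONE-CUBE ESTIMATES AS POWERS OF THE VERTEX FACTOR `θ = e^β(L^kε/ε₀)^{1/4−α}` IN THE `e_k`-SMALL REGIME** (file 2 of 3 of the one-cube part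
`|X_β| = 1` of the leaf (5.14.4); sibling 1 `BIJ88OneCubeSlotEstimates309`, sibling 3 `BIJ88Ineq5144OneCube`).

statement-level skeleton of published theorems with citation tags; proofs where landed; nothing here is a claim about the Yang–Mills mass gap

p. 309, verbatim: *"After integration over A^{(k)}, we obtain factors ct^{−n}e^{−cp(te_k)²} ≤ (e^β(L^kε/ε₀)^{1/4−α})ⁿ"* — the mechanism is this
seat's gen-5 `BIJ88GaussFactor309.exp_pLog_sq_le_pow` (`e^{−cp(x)²} ≤ x^{n+1}` for `0 < x ≤ e_k ≤ 1` once `n + 1 ≤ c|log e_k⁻¹|^{2p−1}`) and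
`e_k ≤ θ` (`BIJ88GaussFactor309.eK_le_vertex`); here with the model's prefactors: the all-orders derivative constant `Ĉⁿ`, the tail constant `A` of
the slot fields (`P{a ≤ |Φ_b|} ≤ A e^{−κa²}`), the interaction weight `e^{K}` (`Σ_Y K_Y ≤ K`).  PDF held:
`paper:balaban1988-cmp114-bij-abelian-higgs-effective-action` (journal page = PDF page + 256); pp. 307, 309 = PDF 51, 53 read this generation.

WHAT IS REPRODUCED (unit `lit-balaban-p36`, generation 15 of the Phase-2 proof seat p36; SKELETON row **C2.Eq5.14.3-5.14.4** member cell, owner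
r16, head untouched; HOME `run/shared/lean/pub/lit-balaban/`).  Theorems only (0 definitions, 0 `Prop` facts):
* §2 REGIME ARITHMETIC: **`shellFactor_le_pow`** (`Ĉⁿ t^{−n} · A e^{−κ′p(te_k)²} · e^{K} ≤ θⁿ` for `n ≤ n₀` when `n₀ + 1 ≤ κ′|log e_k⁻¹|^{2p−1}`,
  `Ĉ^{n₀}Ae^{K}e_k ≤ 1`, `e_k ≤ θ`), **`vacuumFactor_le_rpow`** (`e^{K}·G·A e^{−κ′p(te_k)²} + (e^{K} − 1) ≤ θ^{β′}` when `1 ≤ κ′|log e_k⁻¹|^{2p−1}`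
  and `e^{K}GAe_k + (e^{K} − 1) ≤ θ^{β′}`), `tail_threshold_le` (the tail at a χ-threshold `≥ (9/10)c₀p(te_k)` is below
  `A e^{−κ(81/100)c₀²p(te_k)²}`).
* THE ONE-CUBE ESTIMATES OF SIBLING 1 IN THE REGIME: **`abs_integral_prod_iteratedDeriv_slotFactor_le_pow`** — `1 ≤ Σ_τ m_τ ≤ n₀` derivatives on the
  cube: `|∫ Π_τ (d/dt)^{m_τ} slotFactor_τ dP| ≤ θ^{Σ_τ m_τ}` (*"Each t-derivative of a χ-factor … gives at least a factor θ … Each factor V^{(k)}(Y) in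
  Π (d/dt)_{γ_j} produces a factor θ"*); **`abs_integral_prod_slotFactor_sub_one_le_rpow`** — no derivative: `|∫ χ′_{□,t} e^{−tṼ(□)} dP − 1| ≤ θ^{β′}`
  (p. 307 *"|g₂(X_α) − 1| ≤ θ"*, p. 309 *"The bound for H_β = ∅, |X_β| = 1 was obtained for g₂"*).
HONEST SCOPE: the regime is a list of explicit `e_k`-smallness / interaction-smallness inequalities (hypotheses), each holding for `e_k` small at the
other constants fixed; `θ` enters only through `e_k ≤ θ` (the printed `θ` is a function of the running scale, `BIJ88GaussFactor309.gauss309`); the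
interaction conditions (`K_Y e^{K} ≤ θ`, `e^{K} − 1 ≤ …`) render *"V^{(k)}(Y) is a small polynomial"* for the bounded terms of the model.  Nothing
here is the multi-cube decay of (5.14.4).  0 `sorry`, 0 definitions, 0 `Prop` facts (D-0026); imports `BIJ88OneCubeSlotEstimates309` (p36 g15);
modifies nothing.  NOT summit progress; NOT continuum; NOT Clay.  Cell `lit-balaban` Phase 2, seat p36 gen 15 (owner r16, referee ref-5).
-/

noncomputable section

open Finset MeasureTheory
open Literature.MathematicalPhysics.QuantumFieldTheory.BalabanImbrieJaffe1984to88
open BIJ88Sect2Statements (pLog)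
open BIJ88Sect5Statements (CutoffProfile cutoff)
open BIJ88SlotMoments308 (slotFactor)
open BIJ88GaussFactor309 (exp_pLog_sq_le_pow)
open BIJ88RestrictionsVanish308 (pLog_nonneg)
open BIJ88OneCubeSlotEstimates309

namespace Literature.MathematicalPhysics.QuantumFieldTheory.BalabanImbrieJaffe1984to88.BIJ88OneCubeVertexFactors309

/-! ## §2 The `e_k`-small regime: the Gaussian shell factor and the interaction factors as powers of the vertex factor `θ`

p. 309: *"After integration over A^{(k)}, we obtain factors ct^{−n}e^{−cp(te_k)²} ≤ (e^β(L^kε/ε₀)^{1/4−α})ⁿ"* — the mechanism of this seat's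
`BIJ88GaussFactor309.exp_pLog_sq_le_pow` (`e^{−cp(x)²} ≤ x^{n+1}` for `x ≤ e_k` once `n + 1 ≤ c|log e_k⁻¹|^{2p−1}`), here with the model's
prefactors: the all-orders derivative constant `Ĉ^{n}`, the tail constant `A`, the interaction weight `e^{K}`; and `e_k ≤ θ`
(`BIJ88GaussFactor309.eK_le_vertex`: `e_k ≤ e^β(L^kε/ε₀)^{1/4−α}`). -/

section Regime

/-- **p. 309 «ct^{−n}e^{−cp(te_k)²} ≤ θⁿ» with the model's prefactors**: for `1 ≤ Ĉ`, `0 ≤ A`, `0 ≤ κ′`, `p > 1/2`, `0 < e_k ≤ 1`, `e_k ≤ θ`,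
`0 < t ≤ 1`, `n ≤ n₀`, in the regime `n₀ + 1 ≤ κ′|log e_k⁻¹|^{2p−1}`, `Ĉ^{n₀}·A·e^{K}·e_k ≤ 1`:
`Ĉⁿ t^{−n} · A e^{−κ′p(te_k)²} · e^{K} ≤ θⁿ`. [cite: BalabanImbrieJaffe1988, (5.14.4) p.309] -/
theorem shellFactor_le_pow {C A K κ' p ek t θ : ℝ} {n n₀ : ℕ} (hC1 : 1 ≤ C) (hA : 0 ≤ A) (hκ : 0 ≤ κ') (hp : 1 / 2 < p)
    (hek : 0 < ek) (hek1 : ek ≤ 1) (hekθ : ek ≤ θ) (ht : 0 < t) (ht1 : t ≤ 1) (hn : n ≤ n₀)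
    (hreg : (n₀ : ℝ) + 1 ≤ κ' * Real.log ek⁻¹ ^ (2 * p - 1)) (hpre : C ^ n₀ * A * Real.exp K * ek ≤ 1) :
    C ^ n * t⁻¹ ^ n * (A * Real.exp (-(κ' * pLog p (t * ek) ^ 2))) * Real.exp K ≤ θ ^ n := by
  have hx : 0 < t * ek := mul_pos ht hek
  have hxe : t * ek ≤ ek := mul_le_of_le_one_left hek.le ht1
  have hnn : (n : ℝ) + 1 ≤ (n₀ : ℝ) + 1 := by exact_mod_cast Nat.add_le_add_right hn 1
  have h1 : Real.exp (-(κ' * pLog p (t * ek) ^ 2)) ≤ (t * ek) ^ (n + 1) :=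
    exp_pLog_sq_le_pow hx hxe hek1 hp hκ (hnn.trans hreg)
  have hC0 : 0 < C := by linarith
  have hCn : C ^ n ≤ C ^ n₀ := pow_le_pow_right₀ hC1 hn
  have key : t⁻¹ ^ n * (t * ek) ^ (n + 1) = t * ek ^ (n + 1) := by
    rw [mul_pow, pow_succ t n, inv_pow, ← mul_assoc, ← mul_assoc, inv_mul_cancel₀ (pow_ne_zero n ht.ne'), one_mul]
  have hB : 0 ≤ A * Real.exp K * ek * ek ^ n := by positivity
  calc C ^ n * t⁻¹ ^ n * (A * Real.exp (-(κ' * pLog p (t * ek) ^ 2))) * Real.exp K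
      ≤ C ^ n * t⁻¹ ^ n * (A * (t * ek) ^ (n + 1)) * Real.exp K := by gcongr
    _ = C ^ n * A * Real.exp K * (t⁻¹ ^ n * (t * ek) ^ (n + 1)) := by ring
    _ = C ^ n * t * (A * Real.exp K * ek * ek ^ n) := by rw [key]; ring
    _ ≤ C ^ n₀ * 1 * (A * Real.exp K * ek * ek ^ n) :=
        mul_le_mul (mul_le_mul hCn ht1 ht.le (pow_nonneg hC0.le _)) le_rfl hB (mul_nonneg (pow_nonneg hC0.le _) zero_le_one)
    _ = C ^ n₀ * A * Real.exp K * ek * ek ^ n := by ring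
    _ ≤ 1 * ek ^ n := mul_le_mul_of_nonneg_right hpre (pow_nonneg hek.le n)
    _ = ek ^ n := one_mul _
    _ ≤ θ ^ n := pow_le_pow_left₀ hek.le hekθ n

/-- **the vacuum small factor in the regime**: `e^{K}·G·A e^{−κ′p(te_k)²} + (e^{K} − 1) ≤ θ^{β′}` once `1 ≤ κ′|log e_k⁻¹|^{2p−1}` (so that
`e^{−κ′p(te_k)²} ≤ te_k ≤ e_k`) and `e^{K}·G·A·e_k + (e^{K} − 1) ≤ θ^{β′}` (p. 307: *"extremely small factors when a χ′-factor is replaced by 1"*).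
[cite: BalabanImbrieJaffe1988, p.307 (Sect. 5.13); (5.14.4) p.309] -/
theorem vacuumFactor_le_rpow {A K κ' p ek t θ β' G : ℝ} (hA : 0 ≤ A) (hκ : 0 ≤ κ') (hp : 1 / 2 < p) (hek : 0 < ek)
    (hek1 : ek ≤ 1) (ht : 0 < t) (ht1 : t ≤ 1) (hG : 0 ≤ G) (hreg : (1 : ℝ) ≤ κ' * Real.log ek⁻¹ ^ (2 * p - 1))
    (hvac : Real.exp K * G * A * ek + (Real.exp K - 1) ≤ θ ^ β') :
    Real.exp K * (G * (A * Real.exp (-(κ' * pLog p (t * ek) ^ 2)))) + (Real.exp K - 1) ≤ θ ^ β' := by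
  have hx : 0 < t * ek := mul_pos ht hek
  have hxe : t * ek ≤ ek := mul_le_of_le_one_left hek.le ht1
  have h1 : Real.exp (-(κ' * pLog p (t * ek) ^ 2)) ≤ (t * ek) ^ (0 + 1) :=
    exp_pLog_sq_le_pow hx hxe hek1 hp hκ (by simpa using hreg)
  rw [zero_add, pow_one] at h1
  have h2 : Real.exp (-(κ' * pLog p (t * ek) ^ 2)) ≤ ek := h1.trans hxe
  calc Real.exp K * (G * (A * Real.exp (-(κ' * pLog p (t * ek) ^ 2)))) + (Real.exp K - 1)
      ≤ Real.exp K * (G * (A * ek)) + (Real.exp K - 1) := by gcongr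
    _ = Real.exp K * G * A * ek + (Real.exp K - 1) := by ring
    _ ≤ θ ^ β' := hvac

end Regime

/-! ### The one-cube estimates as powers of `θ` -/

section ThetaForm

variable (χ : CutoffProfile) {ι υ Ω : Type*} [MeasurableSpace Ω] (P : Measure Ω)
variable (p ek : ℝ) (B : Finset ι) (Φ : ι → Ω → ℝ) (c : ι → ℝ) (Ys : Finset υ) (V : υ → Ω → ℝ)

/-- the tail at the threshold of the χ-slot `b` is below the uniform Gaussian shell factor `A e^{−κ(81/100)c₀² p(te_k)²}` (`|c_b| ≥ c₀ > 0`).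
[cite: BalabanImbrieJaffe1988, (5.14.4) p.309] -/
theorem tail_threshold_le {b : ι} {c₀ A κ t : ℝ} (hc₀ : 0 < c₀) (hcb : c₀ ≤ c b) (hA : 0 ≤ A) (hκ : 0 ≤ κ)
    (htail : ∀ a, 0 ≤ a → P.real {ω | a ≤ |Φ b ω|} ≤ A * Real.exp (-(κ * a ^ 2))) :
    P.real {ω | 9 / 10 * (|c b| * pLog p (t * ek)) ≤ |Φ b ω|} ≤
      A * Real.exp (-(κ * (81 / 100) * c₀ ^ 2 * pLog p (t * ek) ^ 2)) := by
  have ha0 : 0 ≤ 9 / 10 * (|c b| * pLog p (t * ek)) := by positivity [pLog_nonneg p (t * ek)]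
  have hc2 : c₀ ^ 2 ≤ |c b| ^ 2 := pow_le_pow_left₀ hc₀.le (hcb.trans (le_abs_self _)) 2
  have hκ' : κ * (81 / 100) * c₀ ^ 2 * pLog p (t * ek) ^ 2 ≤ κ * (9 / 10 * (|c b| * pLog p (t * ek))) ^ 2 := by
    have : κ * (9 / 10 * (|c b| * pLog p (t * ek))) ^ 2 = κ * (81 / 100) * |c b| ^ 2 * pLog p (t * ek) ^ 2 := by ring
    rw [this]
    gcongr
  exact (htail _ ha0).trans (mul_le_mul_of_nonneg_left (Real.exp_le_exp.mpr (neg_le_neg hκ')) hA)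

/-- **(5.14.4) FOR ONE CUBE CARRYING DERIVATIVES, ABSTRACT FORM** (p. 309: *"Each t-derivative of a χ-factor … gives at least a factor
e^β(L^kε/ε₀)^{1/4−α} … Each factor V^{(k)}(Y) in Π (d/dt)_{γ_j} produces a factor e^β(L^kε/ε₀)^{1/4−α} in the final estimate"*): on a probability
space, for the slot family of one cube with measurable slot fields `Φ_b` whose tails satisfy `P{a ≤ |Φ_b|} ≤ A e^{−κa²}` (`a ≥ 0`), thresholds
`c_b ≥ c₀ > 0`, terms `|V(Y)| ≤ K_Y` with `0 ≤ K_Y`, `Σ_Y K_Y ≤ K`, total derivative number `1 ≤ Σ_τ m_τ ≤ n₀`, `0 < t ≤ 1`, `0 < e_k ≤ e⁻¹`, and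
in the regime `e_k ≤ θ`, `n₀ + 1 ≤ κ(81/100)c₀²|log e_k⁻¹|^{2p−1}`, `Ĉ^{n₀}Ae^{K}e_k ≤ 1`, `K_Y e^{K} ≤ θ` (`Ĉ` the all-orders derivative constant):
`|∫ Π_τ (d/dt)^{m_τ} slotFactor_τ dP| ≤ θ^{Σ_τ m_τ}`. [cite: BalabanImbrieJaffe1988, (5.14.4) p.309] -/
theorem abs_integral_prod_iteratedDeriv_slotFactor_le_pow [IsProbabilityMeasure P] {C : ℝ} (hC1 : 1 ≤ C) {n₀ : ℕ}
    (hC : ∀ i, i ≤ n₀ → ∀ (A : ℝ) ⦃q ek t : ℝ⦄, q ≠ 0 → 0 < ek → 0 < t → t * ek ≤ Real.exp (-1) →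
      |iteratedDeriv i (fun s => cutoff χ (q * pLog p (s * ek)) A) t| ≤ C * t ^ (-(i : ℤ)))
    (hp : 1 / 2 < p) {t : ℝ} (hek : 0 < ek) (hek1 : ek ≤ Real.exp (-1)) (ht : 0 < t) (ht1 : t ≤ 1)
    (T : Finset (↥B ⊕ ↥Ys)) (m : ↥B ⊕ ↥Ys → ℕ) (hm : ∑ τ ∈ T, m τ ≤ n₀) (hm1 : 1 ≤ ∑ τ ∈ T, m τ)
    {c₀ : ℝ} (hc₀ : 0 < c₀) (hcb : ∀ b ∈ T.toLeft, c₀ ≤ c b)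
    (KY : υ → ℝ) (hK : ∀ Y ∈ T.toRight, ∀ ω, |V Y ω| ≤ KY Y) (hKY0 : ∀ Y ∈ T.toRight, 0 ≤ KY Y) {K : ℝ}
    (hKsum : ∑ Y ∈ T.toRight, KY Y ≤ K) (hΦ : ∀ b ∈ T.toLeft, Measurable (Φ b))
    {A κ : ℝ} (hA : 0 ≤ A) (hκ : 0 ≤ κ) (htail : ∀ b ∈ T.toLeft, ∀ a, 0 ≤ a → P.real {ω | a ≤ |Φ b ω|} ≤ A * Real.exp (-(κ * a ^ 2)))
    {θ : ℝ} (hekθ : ek ≤ θ) (hreg : (n₀ : ℝ) + 1 ≤ κ * (81 / 100) * c₀ ^ 2 * Real.log ek⁻¹ ^ (2 * p - 1))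
    (hpre : C ^ n₀ * A * Real.exp K * ek ≤ 1) (hKθ : ∀ Y ∈ T.toRight, KY Y * Real.exp K ≤ θ) :
    |∫ ω, ∏ τ ∈ T, iteratedDeriv (m τ) (slotFactor χ p ek B Φ c Ys V ω τ) t ∂P| ≤ θ ^ (∑ τ ∈ T, m τ) := by
  have h1 : t * ek ≤ Real.exp (-1) := (mul_le_of_le_one_left hek.le ht1).trans hek1
  have hek1' : ek ≤ 1 := hek1.trans (Real.exp_le_one_iff.mpr (by norm_num))
  have hθ0 : 0 < θ := hek.trans_le hekθ
  have hC0 : 0 < C := by linarith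
  have hcbne : ∀ b ∈ T.toLeft, c b ≠ 0 := fun b hb => (hc₀.trans_le (hcb b hb)).ne'
  have hK0 : 0 ≤ K := (sum_nonneg hKY0).trans hKsum
  have hsum : ∑ τ ∈ T, m τ = (∑ b ∈ T.toLeft, m (Sum.inl b)) + ∑ Y ∈ T.toRight, m (Sum.inr Y) :=
    Finset.sum_sum_eq_sum_toLeft_add_sum_toRight T m
  set nχ := ∑ b ∈ T.toLeft, m (Sum.inl b) with hnχ
  set nV := ∑ Y ∈ T.toRight, m (Sum.inr Y) with hnV
  have hle : nχ + nV ≤ n₀ := hsum ▸ hm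
  have hge : 1 ≤ nχ + nV := hsum ▸ hm1
  have hKYθ : ∀ Y ∈ T.toRight, KY Y ≤ θ * Real.exp (-K) := fun Y hY => by
    rw [Real.exp_neg, ← div_eq_mul_inv, le_div_iff₀ (Real.exp_pos K)]; exact hKθ Y hY
  have hprodY : ∏ Y ∈ T.toRight, KY Y ^ m (Sum.inr Y) ≤ θ ^ nV * Real.exp (-K) ^ nV := by
    rw [← mul_pow, hnV, ← prod_pow_eq_pow_sum]
    exact prod_le_prod (fun Y hY => pow_nonneg (hKY0 Y hY) _) fun Y hY => pow_le_pow_left₀ (hKY0 Y hY) (hKYθ Y hY) _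
  have hexpK : Real.exp (∑ Y ∈ T.toRight, KY Y) ≤ Real.exp K := Real.exp_le_exp.mpr hKsum
  have hP0 : 0 ≤ Real.exp (-K) ^ nV := pow_nonneg (Real.exp_pos _).le _
  have hP1 : Real.exp (-K) ^ nV ≤ 1 := pow_le_one₀ (Real.exp_pos _).le (Real.exp_le_one_iff.mpr (neg_nonpos.mpr hK0))
  refine abs_integral_le_integral_abs.trans ?_
  by_cases hex : ∃ b₀ ∈ T.toLeft, 1 ≤ m (Sum.inl b₀)
  · -- at least one `t`-derivative on a χ-slot: the Gaussian shell factor of `b₀`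
    obtain ⟨b₀, hb₀, hmb₀⟩ := hex
    have hmχ : ∀ b ∈ T.toLeft, m (Sum.inl b) ≤ n₀ := fun b hb =>
      ((single_le_sum (f := fun b => m (Sum.inl b)) (fun _ _ => Nat.zero_le _) hb).trans (Nat.le_add_right _ _)).trans hle
    have hnχn : nχ ≤ n₀ := (Nat.le_add_right _ _).trans hle
    have hI := integral_abs_prod_iteratedDeriv_slotFactor_le χ P p ek B Φ c Ys V hC1 hC hek ht ht1 h1 T m hmχ hcbne KY hK hKY0
      hΦ hb₀ hmb₀
    have hSle := tail_threshold_le P p ek Φ c (t := t) hc₀ (hcb b₀ hb₀) hA hκ (htail b₀ hb₀)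
    have hshell := shellFactor_le_pow (K := K) hC1 hA (by positivity : 0 ≤ κ * (81 / 100) * c₀ ^ 2) hp hek hek1' hekθ ht ht1
      hnχn hreg hpre
    have hM0 : 0 ≤ C ^ nχ * t⁻¹ ^ nχ := by positivity
    calc ∫ ω, |∏ τ ∈ T, iteratedDeriv (m τ) (slotFactor χ p ek B Φ c Ys V ω τ) t| ∂P
        ≤ C ^ nχ * t⁻¹ ^ nχ * ((∏ Y ∈ T.toRight, KY Y ^ m (Sum.inr Y)) * Real.exp (∑ Y ∈ T.toRight, KY Y)) *
            P.real {ω | 9 / 10 * (|c b₀| * pLog p (t * ek)) ≤ |Φ b₀ ω|} := hI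
      _ ≤ C ^ nχ * t⁻¹ ^ nχ * ((θ ^ nV * Real.exp (-K) ^ nV) * Real.exp K) *
            (A * Real.exp (-(κ * (81 / 100) * c₀ ^ 2 * pLog p (t * ek) ^ 2))) := by
          gcongr
      _ = (C ^ nχ * t⁻¹ ^ nχ * (A * Real.exp (-(κ * (81 / 100) * c₀ ^ 2 * pLog p (t * ek) ^ 2))) * Real.exp K) *
            θ ^ nV * Real.exp (-K) ^ nV := by ring
      _ ≤ θ ^ nχ * θ ^ nV * 1 := by gcongr
      _ = θ ^ (∑ τ ∈ T, m τ) := by rw [hsum, pow_add, mul_one]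
  · -- only interaction slots differentiated
    push Not at hex
    have hm0 : ∀ b ∈ T.toLeft, m (Sum.inl b) = 0 := fun b hb => Nat.lt_one_iff.mp (hex b hb)
    have hnχ0 : nχ = 0 := sum_eq_zero hm0
    have hnV1 : (1 : ℝ) ≤ nV := by
      have h : 1 ≤ nV := by simpa [hnχ0] using hge
      exact_mod_cast h
    have hI := integral_abs_prod_iteratedDeriv_slotFactor_le_of_inr χ P p ek B Φ c Ys V hek ht ht1 h1 T m hm0 hcbne KY hK
    have heK1 : Real.exp (-K) ^ nV * Real.exp K ≤ 1 := by
      rw [← Real.exp_nat_mul, ← Real.exp_add, Real.exp_le_one_iff]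
      nlinarith
    calc ∫ ω, |∏ τ ∈ T, iteratedDeriv (m τ) (slotFactor χ p ek B Φ c Ys V ω τ) t| ∂P
        ≤ (∏ Y ∈ T.toRight, KY Y ^ m (Sum.inr Y)) * Real.exp (∑ Y ∈ T.toRight, KY Y) := hI
      _ ≤ (θ ^ nV * Real.exp (-K) ^ nV) * Real.exp K := by gcongr
      _ = θ ^ nV * (Real.exp (-K) ^ nV * Real.exp K) := by ring
      _ ≤ θ ^ nV * 1 := mul_le_mul_of_nonneg_left heK1 (pow_nonneg hθ0.le _)
      _ = θ ^ (∑ τ ∈ T, m τ) := by rw [hsum, hnχ0, zero_add, mul_one]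

/-- **(5.14.4) FOR ONE CUBE CARRYING NO DERIVATIVE, ABSTRACT FORM** (p. 309: *"If |X_β| = 1, H_β = ∅, we write g₃(∅, X_β) = 1 + g₃′(∅, X_β) …
The bound for H_β = ∅, |X_β| = 1 was obtained for g₂, and the same proof applies here"*; p. 307: *"|g₂(X_α) − 1| ≤ e^β(L^kε/ε₀)^{1/4−α}"*): on a
probability space, `χ ≥ 0`, hypotheses as above with `G ≥` the number of χ-slots of the cube, in the regime `1 ≤ κ(81/100)c₀²|log e_k⁻¹|^{2p−1}`,
`e^{K}·G·A·e_k + (e^{K} − 1) ≤ θ^{β′}`: `|∫ χ′_{□,t} e^{−tṼ(□)} dP − 1| ≤ θ^{β′}`. [cite: BalabanImbrieJaffe1988, p.307 (Sect. 5.13); (5.14.4) p.309] -/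
theorem abs_integral_prod_slotFactor_sub_one_le_rpow [IsProbabilityMeasure P] (hχ : ∀ x, 0 ≤ χ.χ₁ x) (hp : 1 / 2 < p)
    {t : ℝ} (hek : 0 < ek) (hek1 : ek ≤ Real.exp (-1)) (ht : 0 < t) (ht1 : t ≤ 1)
    (T : Finset (↥B ⊕ ↥Ys)) {c₀ : ℝ} (hc₀ : 0 < c₀) (hcb : ∀ b ∈ T.toLeft, c₀ ≤ c b)
    (KY : υ → ℝ) (hK : ∀ Y ∈ T.toRight, ∀ ω, |V Y ω| ≤ KY Y) {K : ℝ} (hKsum : ∑ Y ∈ T.toRight, KY Y ≤ K)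
    (hΦ : ∀ b ∈ T.toLeft, Measurable (Φ b)) (hV : ∀ Y ∈ T.toRight, Measurable (V Y))
    {A κ : ℝ} (hA : 0 ≤ A) (hκ : 0 ≤ κ) (htail : ∀ b ∈ T.toLeft, ∀ a, 0 ≤ a → P.real {ω | a ≤ |Φ b ω|} ≤ A * Real.exp (-(κ * a ^ 2)))
    {G : ℝ} (hG : (T.toLeft.card : ℝ) ≤ G) {θ β' : ℝ} (hreg : (1 : ℝ) ≤ κ * (81 / 100) * c₀ ^ 2 * Real.log ek⁻¹ ^ (2 * p - 1))
    (hvac : Real.exp K * G * A * ek + (Real.exp K - 1) ≤ θ ^ β') :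
    |∫ ω, ∏ τ ∈ T, slotFactor χ p ek B Φ c Ys V ω τ t ∂P - 1| ≤ θ ^ β' := by
  have h1 : t * ek ≤ Real.exp (-1) := (mul_le_of_le_one_left hek.le ht1).trans hek1
  have hek1' : ek ≤ 1 := hek1.trans (Real.exp_le_one_iff.mpr (by norm_num))
  have hcbne : ∀ b ∈ T.toLeft, c b ≠ 0 := fun b hb => (hc₀.trans_le (hcb b hb)).ne'
  have hG0 : 0 ≤ G := (Nat.cast_nonneg _).trans hG
  have hI := abs_integral_prod_slotFactor_sub_one_le χ P p ek B Φ c Ys V hχ hek ht ht1 h1 T hcbne KY hK hΦ hV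
  have hexpK : Real.exp (∑ Y ∈ T.toRight, KY Y) ≤ Real.exp K := Real.exp_le_exp.mpr hKsum
  have hS : ∑ b ∈ T.toLeft, P.real {ω | 9 / 10 * (|c b| * pLog p (t * ek)) ≤ |Φ b ω|} ≤
      G * (A * Real.exp (-(κ * (81 / 100) * c₀ ^ 2 * pLog p (t * ek) ^ 2))) := by
    refine (sum_le_card_nsmul _ _ _ fun b hb => tail_threshold_le P p ek Φ c (t := t) hc₀ (hcb b hb) hA hκ (htail b hb)).trans ?_
    rw [nsmul_eq_mul]
    exact mul_le_mul_of_nonneg_right hG (by positivity)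
  have hvacuum := vacuumFactor_le_rpow (K := K) (θ := θ) (β' := β') hA (by positivity : 0 ≤ κ * (81 / 100) * c₀ ^ 2) hp hek
    hek1' ht ht1 hG0 hreg hvac
  calc |∫ ω, ∏ τ ∈ T, slotFactor χ p ek B Φ c Ys V ω τ t ∂P - 1|
      ≤ Real.exp (∑ Y ∈ T.toRight, KY Y) * ∑ b ∈ T.toLeft, P.real {ω | 9 / 10 * (|c b| * pLog p (t * ek)) ≤ |Φ b ω|} +
          (Real.exp (∑ Y ∈ T.toRight, KY Y) - 1) := hI
    _ ≤ Real.exp K * (G * (A * Real.exp (-(κ * (81 / 100) * c₀ ^ 2 * pLog p (t * ek) ^ 2)))) + (Real.exp K - 1) := by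
        gcongr
    _ ≤ θ ^ β' := hvacuum

end ThetaForm

end Literature.MathematicalPhysics.QuantumFieldTheory.BalabanImbrieJaffe1984to88.BIJ88OneCubeVertexFactors309

end
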